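import Summits.CriticalPhenomena.PercolationContinuityZ3.Theorems.SahiMasterFamilyFCombShiftMatching

/-!
# Relative Kleitman–Hall for two down-sets ("THEOREM T"): the masked disjointness matrix of a union of two
# down-closed families is unimodular (support file, crux `stmt-CriticalPhenomena-4575`, lineage prim-bnk-2 g28)

Support file (`--supports stmt-CriticalPhenomena-4575`; memo `run/shared/lean/prim/prim-l12/FROM-prim-bnk-2-g28-SHARED-KH-PROVED.md`
§1–§2).  No definitions, no `sorry`, standard axioms; it reuses the inclusion-matrix toolkit of `…SahiMasterFamilyFCombShiftDet` /
`…ShiftMatching` (`incl`, `det_incl_self`, `incl_mul_signed_incl`, `sdiffSumEquiv`).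

**THEOREM T (`SahiFComb.Shift.exists_disjoint_equiv_of_union`).**  Let `𝒜, 𝒞` be down-closed families of finite sets and
`L = 𝒜 ∪ 𝒞`.  Then there is a bijection `ψ : L ≃ L` with `x ∩ ψ x = ∅` for every `x` and, moreover, `ψ x ∈ 𝒞` whenever `x ∉ 𝒜`.
(`𝒞 ⊆ 𝒜` is the classical "Kleitman–Hall for a down-set", `det DS[L,L] = ±1`.)

Proof (memo §2).  Let `M(x,y) = [x ∩ y = ∅]·[x ∈ 𝒜 ∨ y ∈ 𝒞]` on `L × L` and `μ = Λ ζ[L,L] Λ` the Möbius matrix of the down-set `L`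
(`incl_mul_signed_incl`).  For `P := M·μ` one has `M = P·ζ[L,L]`, and `P(x,G) = (−1)^{#G}[G ⊆ x]` whenever `x ∈ 𝒜` or `G ∈ 𝒞`
(binomial identity over the Boolean interval below `G \ x`, which lies inside `L`).  Hence in the decomposition `L = (L \ 𝒜) ⊔ 𝒜` the
matrix `P` is block upper triangular (`P(x,G) = 0` for `x ∈ 𝒜`, `G ∉ 𝒜`) with diagonal blocks `ζ[L\𝒜]ᵀΛ` and `ζ[𝒜]ᵀΛ`, so
`det M = det P = ±1`, and a nonzero Leibniz term of `det M` is the bijection.  The corollary "shared Kleitman–Hall" (CLAIM 2 of memo g27 =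
the tree's `ThreePartition.ColumnSharedKleitmanHall`) is assembled in the companion file `…ThreePartitionColumnSharedKH`. [this work]
-/

namespace Summit.CriticalPhenomena.PercolationContinuityZ3.Theorems

namespace SahiFComb.Shift

open Finset Matrix

variable {α : Type*} [DecidableEq α]

/-- The binomial identity behind THEOREM T: inside a down-closed family `L`, for `G ∈ L`,
`Σ_{y ∈ L, y ⊆ G, y ∩ x = ∅} (−1)^{#y} = [G ⊆ x]`. [folklore] -/
theorem sum_disjoint_below_neg_one_pow {L : Finset (Finset α)} (hL : ∀ K ∈ L, ∀ K' ⊆ K, K' ∈ L)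
    (x G : Finset α) (hG : G ∈ L) :
    (∑ y ∈ L, if y ⊆ G ∧ Disjoint x y then (-1 : ℤ) ^ #y else 0) = if G ⊆ x then 1 else 0 := by
  rw [← Finset.sum_filter]
  have hset : L.filter (fun y => y ⊆ G ∧ Disjoint x y) = (G \ x).powerset := by
    ext y
    simp only [mem_filter, mem_powerset]
    constructor
    · rintro ⟨-, hyG, hxy⟩
      intro a ha
      exact mem_sdiff.2 ⟨hyG ha, fun hax => disjoint_left.1 hxy hax ha⟩
    · intro hy
      refine ⟨hL G hG y (hy.trans sdiff_subset), hy.trans sdiff_subset, ?_⟩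
      exact disjoint_of_subset_right hy disjoint_sdiff
  rw [hset, Finset.sum_powerset_neg_one_pow_card]
  exact if_congr sdiff_eq_empty_iff_subset rfl rfl

/-- **THEOREM T — relative Kleitman–Hall for two down-sets** (prim-bnk-2 g28).  For down-closed families `𝒜, 𝒞` with
`L = 𝒜 ∪ 𝒞` there is a bijection `ψ : L ≃ L` with `x ∩ ψ x = ∅` and (`x ∈ 𝒜` or `ψ x ∈ 𝒞`) for every `x ∈ L`; i.e. the
members of `L` outside `𝒜` are matched inside `𝒞`.  Proof: the masked disjointness matrix `[x∩y=∅][x∈𝒜 ∨ y∈𝒞]` equals `P·ζ[L,L]`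
with `P` block triangular with unitriangular-times-sign diagonal blocks, hence has determinant `±1`. [this work] -/
theorem exists_disjoint_equiv_of_union [LinearOrder α] {𝒜 𝒞 : Finset (Finset α)}
    (h𝒜 : ∀ K ∈ 𝒜, ∀ K' ⊆ K, K' ∈ 𝒜) (h𝒞 : ∀ K ∈ 𝒞, ∀ K' ⊆ K, K' ∈ 𝒞) :
    ∃ ψ : ↥(𝒜 ∪ 𝒞) ≃ ↥(𝒜 ∪ 𝒞), ∀ x : ↥(𝒜 ∪ 𝒞),
      Disjoint (x : Finset α) ((ψ x : ↥(𝒜 ∪ 𝒞)) : Finset α) ∧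
        ((x : Finset α) ∈ 𝒜 ∨ ((ψ x : ↥(𝒜 ∪ 𝒞)) : Finset α) ∈ 𝒞) := by
  classical
  set L : Finset (Finset α) := 𝒜 ∪ 𝒞 with hLdef
  have hL : ∀ K ∈ L, ∀ K' ⊆ K, K' ∈ L := by
    intro K hK K' hK'
    rcases mem_union.1 hK with h | h
    · exact mem_union_left _ (h𝒜 K h K' hK')
    · exact mem_union_right _ (h𝒞 K h K' hK')
  have h𝒜L : 𝒜 ⊆ L := subset_union_left
  -- the masked disjointness matrix
  let M : Matrix ↥L ↥L ℤ := Matrix.of fun x y =>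
    if Disjoint (x : Finset α) (y : Finset α) ∧ ((x : Finset α) ∈ 𝒜 ∨ (y : Finset α) ∈ 𝒞) then 1 else 0
  -- the Möbius matrix of the down-set `L`
  let Mu : Matrix ↥L ↥L ℤ := Matrix.of fun (J K : ↥L) =>
    (-1 : ℤ) ^ (#(J : Finset α) + #(K : Finset α)) * (if (J : Finset α) ⊆ (K : Finset α) then 1 else 0)
  have hζμ : incl L L * Mu = 1 := incl_mul_signed_incl hL
  have hμζ : Mu * incl L L = 1 := mul_eq_one_comm.1 hζμ
  let P : Matrix ↥L ↥L ℤ := M * Mu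
  have hPζ : P * incl L L = M := by
    show M * Mu * incl L L = M
    rw [Matrix.mul_assoc, hμζ, Matrix.mul_one]
  -- entries of `P` off the "bad" block
  have hP : ∀ x G : ↥L, ((x : Finset α) ∈ 𝒜 ∨ (G : Finset α) ∈ 𝒞) →
      P x G = (-1) ^ #(G : Finset α) * (if (G : Finset α) ⊆ (x : Finset α) then 1 else 0) := by
    intro x G hxG
    show (M * Mu) x G = _
    rw [Matrix.mul_apply]
    have e1 : ∀ y : ↥L, M x y * Mu y G =
        (-1) ^ #(G : Finset α) * (if (y : Finset α) ⊆ G ∧ Disjoint (x : Finset α) y then (-1) ^ #(y : Finset α) else 0) := by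
      intro y
      simp only [M, Mu, Matrix.of_apply]
      by_cases hyG : (y : Finset α) ⊆ (G : Finset α)
      · by_cases hd : Disjoint (x : Finset α) (y : Finset α)
        · have hmask : (x : Finset α) ∈ 𝒜 ∨ (y : Finset α) ∈ 𝒞 := by
            rcases hxG with h | h
            · exact Or.inl h
            · exact Or.inr (h𝒞 _ h _ hyG)
          rw [if_pos ⟨hd, hmask⟩, if_pos hyG, if_pos ⟨hyG, hd⟩, pow_add]; ring
        · rw [if_neg (show ¬ (Disjoint (x : Finset α) (y : Finset α) ∧ ((x : Finset α) ∈ 𝒜 ∨ (y : Finset α) ∈ 𝒞))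
              from fun h => hd h.1),
            if_neg (show ¬ ((y : Finset α) ⊆ (G : Finset α) ∧ Disjoint (x : Finset α) (y : Finset α)) from fun h => hd h.2)]
          ring
      · rw [if_neg hyG, if_neg (show ¬ ((y : Finset α) ⊆ (G : Finset α) ∧ Disjoint (x : Finset α) (y : Finset α))
            from fun h => hyG h.1)]
        ring
    rw [Fintype.sum_congr _ _ e1, ← Finset.mul_sum,
      Finset.sum_coe_sort L (fun y => if y ⊆ (G : Finset α) ∧ Disjoint (x : Finset α) y then (-1 : ℤ) ^ #y else 0),
      sum_disjoint_below_neg_one_pow hL (x : Finset α) (G : Finset α) G.2]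
  -- block decomposition `L = (L \ 𝒜) ⊔ 𝒜`
  let e : ↥(L \ 𝒜) ⊕ ↥𝒜 ≃ ↥L := sdiffSumEquiv L 𝒜 h𝒜L
  have he_inl : ∀ z : ↥(L \ 𝒜), ((e (Sum.inl z) : ↥L) : Finset α) = z := fun z => rfl
  have he_inr : ∀ z : ↥𝒜, ((e (Sum.inr z) : ↥L) : Finset α) = z := fun z => rfl
  have hsd𝒞 : ∀ z : ↥(L \ 𝒜), (z : Finset α) ∈ 𝒞 := fun z => by
    have hz1 : (z : Finset α) ∈ 𝒜 ∪ 𝒞 := (mem_sdiff.1 z.2).1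
    exact (mem_union.1 hz1).resolve_left (mem_sdiff.1 z.2).2
  have hsdn𝒜 : ∀ z : ↥(L \ 𝒜), (z : Finset α) ∉ 𝒜 := fun z => (mem_sdiff.1 z.2).2
  let P' : Matrix (↥(L \ 𝒜) ⊕ ↥𝒜) (↥(L \ 𝒜) ⊕ ↥𝒜) ℤ := P.submatrix e e
  have h21 : P'.toBlocks₂₁ = 0 := by
    ext x G
    simp only [P', Matrix.toBlocks₂₁, Matrix.of_apply, submatrix_apply, Matrix.zero_apply]
    rw [hP _ _ (Or.inl (by rw [he_inr]; exact x.2)), he_inr, he_inl, if_neg, mul_zero]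
    intro hsub
    exact hsdn𝒜 G (h𝒜 _ x.2 _ hsub)
  have h11 : P'.toBlocks₁₁ = (incl (L \ 𝒜) (L \ 𝒜))ᵀ * Matrix.diagonal (fun G : ↥(L \ 𝒜) => (-1 : ℤ) ^ #(G : Finset α)) := by
    ext x G
    simp only [P', Matrix.toBlocks₁₁, Matrix.of_apply, submatrix_apply, Matrix.mul_diagonal, Matrix.transpose_apply,
      incl_apply]
    rw [hP _ _ (Or.inr (by rw [he_inl]; exact hsd𝒞 G)), he_inl, he_inl, mul_comm]
  have h22 : P'.toBlocks₂₂ = (incl 𝒜 𝒜)ᵀ * Matrix.diagonal (fun G : ↥𝒜 => (-1 : ℤ) ^ #(G : Finset α)) := by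
    ext x G
    simp only [P', Matrix.toBlocks₂₂, Matrix.of_apply, submatrix_apply, Matrix.mul_diagonal, Matrix.transpose_apply,
      incl_apply]
    rw [hP _ _ (Or.inl (by rw [he_inr]; exact x.2)), he_inr, he_inr, mul_comm]
  have hdetP : IsUnit P.det := by
    rw [← Matrix.det_submatrix_equiv_self e P]
    change IsUnit P'.det
    rw [← Matrix.fromBlocks_toBlocks P', h21, Matrix.det_fromBlocks_zero₂₁, h11, h22, Matrix.det_mul, Matrix.det_mul,
      Matrix.det_transpose, Matrix.det_transpose, det_incl_self, det_incl_self, one_mul, one_mul, Matrix.det_diagonal,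
      Matrix.det_diagonal]
    exact (isUnit_prod_neg_one_pow _).mul (isUnit_prod_neg_one_pow _)
  have hdetM : IsUnit M.det := by
    rw [← hPζ, Matrix.det_mul, det_incl_self, mul_one]
    exact hdetP
  -- Leibniz: a nonzero permutation term is an admissible perfect matching
  have hne : M.det ≠ 0 := hdetM.ne_zero
  rw [Matrix.det_apply'] at hne
  obtain ⟨σ, -, hσ⟩ := Finset.exists_ne_zero_of_sum_ne_zero hne
  have hσ' : ∀ i : ↥L, M (σ i) i ≠ 0 := fun i =>
    (Finset.prod_ne_zero_iff.1 (mul_ne_zero_iff.1 hσ).2) i (Finset.mem_univ _)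
  refine ⟨σ.symm, fun x => ?_⟩
  have hx := hσ' (σ.symm x)
  rw [Equiv.apply_symm_apply] at hx
  simp only [M, Matrix.of_apply, ne_eq, ite_eq_right_iff, one_ne_zero, imp_false, not_not] at hx
  exact hx

/-- THEOREM T in "dominating" form: for down-closed `𝒜, 𝒞 ⊆ 𝒫(R)` with `L = 𝒜 ∪ 𝒞` there is a bijection `φ` from `L` onto
`{R \ y : y ∈ L}` realised as `φ x = R \ ψ x` with `x ⊆ φ x`, such that `R \ φ x ∈ 𝒞` whenever `x ∉ 𝒜`.  (Packaging of
`exists_disjoint_equiv_of_union` used by the shared Kleitman–Hall corollary.) [this work] -/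
theorem exists_disjoint_equiv_of_union' [LinearOrder α] {𝒜 𝒞 : Finset (Finset α)} (R : Finset α)
    (h𝒜 : ∀ K ∈ 𝒜, ∀ K' ⊆ K, K' ∈ 𝒜) (h𝒞 : ∀ K ∈ 𝒞, ∀ K' ⊆ K, K' ∈ 𝒞)
    (h𝒜R : ∀ K ∈ 𝒜, K ⊆ R) (h𝒞R : ∀ K ∈ 𝒞, K ⊆ R) :
    ∃ ψ : ↥(𝒜 ∪ 𝒞) ≃ ↥(𝒜 ∪ 𝒞), ∀ x : ↥(𝒜 ∪ 𝒞),
      (x : Finset α) ⊆ R \ ((ψ x : ↥(𝒜 ∪ 𝒞)) : Finset α) ∧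
        ((x : Finset α) ∉ 𝒜 → ((ψ x : ↥(𝒜 ∪ 𝒞)) : Finset α) ∈ 𝒞) := by
  obtain ⟨ψ, hψ⟩ := exists_disjoint_equiv_of_union h𝒜 h𝒞
  refine ⟨ψ, fun x => ⟨?_, fun hx => (hψ x).2.resolve_left hx⟩⟩
  have hxR : (x : Finset α) ⊆ R := by
    rcases mem_union.1 x.2 with h | h
    · exact h𝒜R _ h
    · exact h𝒞R _ h
  intro a ha
  exact mem_sdiff.2 ⟨hxR ha, fun ha' => disjoint_left.1 (hψ x).1 ha ha'⟩

end SahiFComb.Shift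

end Summit.CriticalPhenomena.PercolationContinuityZ3.Theorems
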